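import Literature.Algebra.Homology.TateNakayama
import Literature.Algebra.Homology.GroupCohomologyCupProductConnecting
import Literature.Algebra.Homology.GroupCohomologyCupProductCoefficientsCommutative
import Literature.Algebra.Homology.GroupCohomologyCupProductLowDegree
import HarnessLib

/-!
# The Tate–Nakayama map IS the cup product with the fundamental class (Harari Prop. 3.13), in
# degrees `≥ 1`: `res_U[φ] ∪ x = δδ(1 ∪ x)`, and `x ↦ res_U[φ] ∪ x : Hⁿ(U, M) → Hⁿ⁺²(U, C ⊗ M)` is
# bijective for a class module `C` and torsion-free `M`

Topic `Algebra/Homology`; namespace `Literature.Algebra.Homology`.  Theorems only (no definition, no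
named fact, no instance).  Sequel of `TateNakayama` (door-c4 g12: the Tate–Nakayama isomorphism
`Ĥⁿ(U, M) ≅ Ĥⁿ⁺²(U, C ⊗ M)` realised CUP-PRODUCT-FREE as `δ ∘ δ` through the splitting module) and of
`GroupCohomologyCupProductConnecting` (Brown V (3.3) `δ(u ∪ v) = δu ∪ v` for the tree's cup product
`cupProductRep` on Mathlib's `groupCohomology`).

D. Harari, *Galois Cohomology and Class Field Theory* (2020), Prop. 3.13 / Thm. 3.14: for a class module
`(C, [φ])` of the finite group `G`, a subgroup `U` and a torsion-free `M`, "the cup-product by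
`a_U = Res_U(a)` induces isomorphisms `Ĥⁿ(U, M) → Ĥⁿ⁺²(U, C ⊗ M)`", the map being "obtained (up to a sign)
by composing" the connecting isomorphisms of `0 → I_G ⊗ M → ℤ[G] ⊗ M → M → 0` and
`0 → C ⊗ M → C(φ) ⊗ M → I_G ⊗ M → 0` (`C(φ)` the splitting module).  Here, in ORDINARY cohomology and
with the fundamental class on the LEFT (so that Brown (3.3) applies with NO sign):

* §1 `augShortComplex_res_tensor_shortExact`, `splittingShortComplex_res_tensor_shortExact` — the two
  sequences restricted to `U` and tensored on the right with `Res_U M` (`M` flat over `k`) are short exact.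
* §2 **`cupProductRep_res_H2π_eq_δ_δ`** — for ANY group `G`, any `2`-cocycle `φ` of `A : Rep k G`, any
  subgroup `U`, any `k`-flat `M` and `x ∈ Hⁿ(U, M)`:
  `res_U[φ] ∪ x = δ_{C(φ)⊗M}(δ_{k[G]⊗M}(ζ ∪ x))` in `Hⁿ⁺²(U, Res_U A ⊗ Res_U M)`, `ζ = 1 ∈ H⁰(U, k)`
  (Lang III §3: `δζ = β`, `δβ = res_U[φ]` — the tree's `SplittingModule.δ_zeta`, `δ_beta` — and Brown (3.3)
  twice); `cupProductRep_zeta_eq` — `ζ ∪ x = (λ_M)⁻¹_* x`.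
* §3 for a CLASS MODULE `C` over `ℤ` (`G` finite, `IsClassModule C φ`) and torsion-free `M`:
  **`IsClassModule.cupProductRep_H2π_bijective`** — `x ↦ res_U[φ] ∪ x : Hⁿ(U, M) → Hⁿ⁺²(U, C ⊗ M)` is
  BIJECTIVE for every `n ≥ 1` (the two `δ`'s are isomorphisms: `ℤ[G] ⊗ M` and `C(φ) ⊗ M` are
  cohomologically trivial, the tree's `isCohomologicallyTrivial_leftRegular_tensor` /
  `splittingShortComplex_tensor_shortExact`).  So door-c4's `tateNakayamaIso` in degrees `n ≥ 1` is, as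
  printed, the cup product with `res_U[φ]` (up to the identification `Res_U(C ⊗ M) = Res_U C ⊗ Res_U M`).

USE (Route A to Poitou–Tate, cell bsd-schneider-ideate): Milne *ADT* I Lemma 1.9 / Harari Lemma 16.20
(`Ext^r_G(N, C) = 0`, `r ≥ 3`, `N` torsion-free, for a PROFINITE class formation) is the statement that
`colim_U H^r(G/U, N ⊗ C^U) = 0`; under the Tate–Nakayama isomorphisms the transition maps are
`(U:V) · Inf` BECAUSE the isomorphism is `· ∪ u_U` and `Inf(u_U ∪ x) = Inf u_U ∪ Inf x = (U:V)(u_V ∪ Inf x)`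
(Brown (3.7) with coefficients, the tree's `map_res_cupProductRep`, and `Inf u_U = (U:V) u_V`).  This file
supplies the missing identification «Tate–Nakayama = cup product».

## References
* D. Harari, *Galois Cohomology and Class Field Theory*, Universitext (2020), Prop. 3.13, Thm. 3.14.
  [Harari2020]
* S. Lang, *Topics in Cohomology of Groups* (1996), III §3 Thm. 3.1–3.2 (`δζ = β`, `δβ = α`). [Lang1996]
* K. S. Brown, *Cohomology of Groups* (1982), V §3 (3.3), (3.4), (3.7). [Brown1982CohomologyGroups]
* J. S. Milne, *Arithmetic Duality Theorems* (2006), I Lemma 1.9 (the use). [MilneADT2006]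
-/

noncomputable section

open CategoryTheory CategoryTheory.Limits MonoidalCategory groupCohomology
open scoped TensorProduct

universe u

namespace Literature.Algebra.Homology

open SplittingModule CohomologicallyTrivial

/-! ## §1 The two sequences, restricted to `U` and tensored with `Res_U M` -/

section Sequences

variable {k G : Type u} [CommRing k] [Group G]

/-- **`0 → I_G ⊗ M → k[G] ⊗ M → k ⊗ M → 0` restricted to `U` is short exact** (`M` flat over `k`):
the augmentation sequence `0 → I_G → k[G] → k → 0` restricted to `U` (`augShortComplex_res_shortExact`)
tensored on the right with `Res_U M` (`shortExact_map_tensorRight`).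
[cite: Lang1996, III §3 (preamble to Thm. 3.1)] [cite: Harari2020, Thm. 3.14 (proof)] -/
theorem augShortComplex_res_tensor_shortExact (U : Subgroup G) (M : Rep.{u} k G) [Module.Flat k M.V] :
    ((((augShortComplex k G).map (Rep.resFunctor U.subtype))).map
      (tensorRight (Rep.res U.subtype M))).ShortExact :=
  shortExact_map_tensorRight (augShortComplex_res_shortExact k U) (Rep.res U.subtype M)

/-- **`0 → A ⊗ M → A(φ) ⊗ M → I_G ⊗ M → 0` restricted to `U` is short exact** (`A(φ)` the splitting
module of the `2`-cocycle `φ`, `M` flat over `k`). [cite: Lang1996, III §3 Thm. 3.2 (proof)]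
[cite: Harari2020, Thm. 3.14 (proof)] -/
theorem splittingShortComplex_res_tensor_shortExact (A : Rep.{u} k G) (φ : cocycles₂ A)
    (U : Subgroup G) (M : Rep.{u} k G) [Module.Flat k M.V] :
    ((((splittingShortComplex A φ).map (Rep.resFunctor U.subtype))).map
      (tensorRight (Rep.res U.subtype M))).ShortExact :=
  shortExact_map_tensorRight (splittingShortComplex_res_shortExact A φ U) (Rep.res U.subtype M)

end Sequences

/-! ## §2 `res_U[φ] ∪ x = δδ(ζ ∪ x)` -/

section CupDelta

variable {k G : Type u} [CommRing k] [Group G] (A : Rep.{u} k G) (φ : cocycles₂ A) (U : Subgroup G)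
  (M : Rep.{u} k G) [Module.Flat k M.V] {n : ℕ}

/-- **`β_U ∪ x = δ(ζ ∪ x)`**: for `x ∈ Hⁿ(U, M)`, the cup product of the class `β_U ∈ H¹(U, I_G)` of
`σ ↦ σ - e` with `x` is the image of `ζ ∪ x` (`ζ = 1 ∈ H⁰(U, k)`) under the connecting homomorphism of
`0 → I_G ⊗ M → k[G] ⊗ M → k ⊗ M → 0` (Lang: `δζ = β`; Brown (3.3): `δ(u ∪ v) = δu ∪ v`).
[cite: Lang1996, III §3 Thm. 3.1 (proof)] [cite: Brown1982CohomologyGroups, V §3 (3.3)] -/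
theorem cupProductRep_beta_eq_δ (x : groupCohomology (Rep.res U.subtype M) n) :
    cupProductRep (Rep.res U.subtype (augIdeal k G)) (Rep.res U.subtype M) (Nat.add_comm 1 n)
        (beta k U) x =
      δ (augShortComplex_res_tensor_shortExact U M) n (n + 1) rfl
        (cupProductRep (Rep.res U.subtype (Rep.trivial k G k)) (Rep.res U.subtype M) (zero_add n)
          ((H0Iso (Rep.res U.subtype (Rep.trivial k G k))).inv (zeta k U)) x) := by
  have h1 := δ_cupProductRep_left (augShortComplex_res_shortExact k U) (Rep.res U.subtype M)
    (augShortComplex_res_tensor_shortExact U M) (zero_add n)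
    ((H0Iso (Rep.res U.subtype (Rep.trivial k G k))).inv (zeta k U)) x
  have h2 := congrArg (fun c => cupProductRep (Rep.res U.subtype (augIdeal k G)) (Rep.res U.subtype M)
    (Nat.add_comm 1 n) c x) (δ_zeta k U)
  exact h2.symm.trans h1.symm

/-- **`res_U[φ] ∪ x = δ(β_U ∪ x)`**: for `x ∈ Hⁿ(U, M)`, the cup product of the restricted class
`res_U[φ] ∈ H²(U, A)` with `x` is the image of `β_U ∪ x` under the connecting homomorphism of
`0 → A ⊗ M → A(φ) ⊗ M → I_G ⊗ M → 0` (Lang: `δβ = res_U[φ]`; Brown (3.3)).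
[cite: Lang1996, III §3 Thm. 3.1 (proof)] [cite: Brown1982CohomologyGroups, V §3 (3.3)] -/
theorem cupProductRep_res_H2π_eq_δ (x : groupCohomology (Rep.res U.subtype M) n) :
    cupProductRep (Rep.res U.subtype A) (Rep.res U.subtype M) (Nat.add_comm 2 n)
        (map U.subtype (𝟙 (Rep.res U.subtype A)) 2 (H2π A φ)) x =
      δ (splittingShortComplex_res_tensor_shortExact A φ U M) (n + 1) (n + 2) rfl
        (cupProductRep (Rep.res U.subtype (augIdeal k G)) (Rep.res U.subtype M) (Nat.add_comm 1 n)
          (beta k U) x) := by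
  have h1 := δ_cupProductRep_left (splittingShortComplex_res_shortExact A φ U) (Rep.res U.subtype M)
    (splittingShortComplex_res_tensor_shortExact A φ U M) (Nat.add_comm 1 n) (beta k U) x
  have h2 := congrArg (fun c => cupProductRep (Rep.res U.subtype A) (Rep.res U.subtype M)
    (Nat.add_comm 2 n) c x) (δ_beta A φ U)
  exact h2.symm.trans h1.symm

/-- **Harari Prop. 3.13 in ordinary cohomology: `res_U[φ] ∪ x = δ(δ(ζ ∪ x))`** for every group `G`,
`2`-cocycle `φ` of `A`, subgroup `U`, `k`-flat `M` and `x ∈ Hⁿ(U, M)` — the composite of the connecting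
homomorphisms of `0 → I_G ⊗ M → k[G] ⊗ M → k ⊗ M → 0` and `0 → A ⊗ M → A(φ) ⊗ M → I_G ⊗ M → 0`
(door-c4's cup-product-free Tate–Nakayama map) applied to `ζ ∪ x`, `ζ = 1 ∈ H⁰(U, k)`.
[cite: Harari2020, Prop. 3.13] [cite: Lang1996, III §3 Thm. 3.1 (proof)] -/
theorem cupProductRep_res_H2π_eq_δ_δ (x : groupCohomology (Rep.res U.subtype M) n) :
    cupProductRep (Rep.res U.subtype A) (Rep.res U.subtype M) (Nat.add_comm 2 n)
        (map U.subtype (𝟙 (Rep.res U.subtype A)) 2 (H2π A φ)) x =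
      δ (splittingShortComplex_res_tensor_shortExact A φ U M) (n + 1) (n + 2) rfl
        (δ (augShortComplex_res_tensor_shortExact U M) n (n + 1) rfl
          (cupProductRep (Rep.res U.subtype (Rep.trivial k G k)) (Rep.res U.subtype M) (zero_add n)
            ((H0Iso (Rep.res U.subtype (Rep.trivial k G k))).inv (zeta k U)) x)) := by
  rw [cupProductRep_res_H2π_eq_δ, cupProductRep_beta_eq_δ]

end CupDelta

/-! ## §3 The unit `ζ ∪ x = (λ_M)⁻¹_* x` and the vanishing inputs -/

section Unit

variable {k G : Type u} [CommRing k] [Group G] (U : Subgroup G) (M : Rep.{u} k G) {n : ℕ}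

/-- **`ζ ∪ x = (λ_M)⁻¹_* x`** for `ζ = 1 ∈ H⁰(U, k)` and `x ∈ Hⁿ(U, M)`: the cup product with the unit
class is the map induced by the inverse left unitor `M → k ⊗ M`, `y ↦ 1 ⊗ y` (Brown (3.1)/(3.4), Harari
Remark 2.22; the tree's `cupProductRep_H0Iso_inv_left`).  (`Res_U k = k` definitionally.)
[cite: Brown1982CohomologyGroups, V §3 (3.4)] [cite: Harari2020, Remark 2.22] -/
theorem cupProductRep_zeta_eq (x : groupCohomology (Rep.res U.subtype M) n) :
    cupProductRep (Rep.res U.subtype (Rep.trivial k G k)) (Rep.res U.subtype M) (zero_add n)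
        ((H0Iso (Rep.res U.subtype (Rep.trivial k G k))).inv (zeta k U)) x =
      map (MonoidHom.id U) (λ_ (Rep.res U.subtype M)).inv n x := by
  rw [cupProductRep_H0Iso_inv_left]
  have h : tmulLeftHom (Rep.res U.subtype (Rep.trivial k G k)) (Rep.res U.subtype M) (zeta k U) =
      (λ_ (Rep.res U.subtype M)).inv := by
    apply Rep.hom_ext
    ext y
    rfl
  rw [h]
  rfl

/-- `Hⁿ(id, e)` is bijective for an isomorphism `e` of coefficients. [folklore] -/
private theorem map_id_bijective_of_iso {H : Type u} [Group H] {A B : Rep.{u} k H} (e : A ≅ B) (n : ℕ) :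
    Function.Bijective (map (MonoidHom.id H) e.hom n) := by
  refine Function.bijective_iff_has_inverse.2 ⟨map (MonoidHom.id H) e.inv n, fun x => ?_, fun y => ?_⟩
  · change (map (MonoidHom.id H) e.hom n ≫ map (MonoidHom.id H) e.inv n) x = x
    rw [← map_id_comp, e.hom_inv_id, map_id]
    rfl
  · change (map (MonoidHom.id H) e.inv n ≫ map (MonoidHom.id H) e.hom n) y = y
    rw [← map_id_comp, e.inv_hom_id, map_id]
    rfl

/-- **`x ↦ ζ ∪ x : Hⁿ(U, M) → Hⁿ(U, k ⊗ M)` is bijective** (it is `(λ_M)⁻¹_*`).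
[cite: Brown1982CohomologyGroups, V §3 (3.4)] -/
theorem cupProductRep_zeta_bijective :
    Function.Bijective (fun x : groupCohomology (Rep.res U.subtype M) n =>
      cupProductRep (Rep.res U.subtype (Rep.trivial k G k)) (Rep.res U.subtype M) (zero_add n)
        ((H0Iso (Rep.res U.subtype (Rep.trivial k G k))).inv (zeta k U)) x) := by
  have h : (fun x : groupCohomology (Rep.res U.subtype M) n =>
      cupProductRep (Rep.res U.subtype (Rep.trivial k G k)) (Rep.res U.subtype M) (zero_add n)
        ((H0Iso (Rep.res U.subtype (Rep.trivial k G k))).inv (zeta k U)) x) =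
      fun x => map (MonoidHom.id U) (λ_ (Rep.res U.subtype M)).inv n x :=
    funext (cupProductRep_zeta_eq U M)
  rw [h]
  exact map_id_bijective_of_iso (λ_ (Rep.res U.subtype M)).symm n

/-- **Positive-degree cohomology of a cohomologically trivial module vanishes on every subgroup**:
`Hⁿ(U, A) = Ĥⁿ(U, A) = 0` for `n ≥ 1` (Mathlib's `TateCohomology.isoGroupCohomology`).
[cite: Serre1979, IX §3] -/
theorem _root_.Literature.Algebra.Homology.IsCohomologicallyTrivial.isZero_groupCohomology_res
    {A : Rep.{u} k G} (hA : IsCohomologicallyTrivial A) (U : Subgroup G) [Fintype U] (n : ℕ) [NeZero n] :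
    IsZero (groupCohomology (Rep.res U.subtype A) n) :=
  (hA U n).of_iso ((TateCohomology.isoGroupCohomology n).app (Rep.res U.subtype A)).symm

end Unit

/-! ## §4 Class modules: `x ↦ res_U[φ] ∪ x` is the Tate–Nakayama ISOMORPHISM in degrees `≥ 1` -/

section ClassModule

variable {G : Type} [Group G] [Fintype G] {C : Rep.{0} ℤ G} {φ : cocycles₂ C}

/-- **`δ : Hⁿ(U, ℤ ⊗ M) → Hⁿ⁺¹(U, I_G ⊗ M)` is bijective for `n ≥ 1`** (`M` torsion-free): `ℤ[G] ⊗ M` is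
cohomologically trivial (the tree's `isCohomologicallyTrivial_leftRegular_tensor`).
[cite: Harari2020, Thm. 3.14 (proof)] [cite: Lang1996, III §3] -/
theorem δ_augShortComplex_res_tensor_bijective (M : Rep.{0} ℤ G) [IsAddTorsionFree M.V] (U : Subgroup G)
    (n : ℕ) [NeZero n] :
    haveI := PGroupModule.flat_of_isAddTorsionFree M
    Function.Bijective
      (groupCohomology.δ (augShortComplex_res_tensor_shortExact U M) n (n + 1) rfl) := by
  haveI := PGroupModule.flat_of_isAddTorsionFree M
  letI : Fintype U := Fintype.ofFinite U
  have hct := isCohomologicallyTrivial_leftRegular_tensor ℤ G M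
  haveI := isIso_δ_of_isZero (augShortComplex_res_tensor_shortExact U M) n
    (hct.isZero_groupCohomology_res U n) (hct.isZero_groupCohomology_res U (n + 1))
  exact ConcreteCategory.bijective_of_isIso _

/-- **`δ : Hⁿ⁺¹(U, I_G ⊗ M) → Hⁿ⁺²(U, C ⊗ M)` is bijective** for a class module `C` with fundamental
class `[φ]` and torsion-free `M`: `C(φ) ⊗ M` is cohomologically trivial (Tate's theorem + Serre IX §5
Thm. 9 Cor., the tree's `splittingShortComplex_tensor_shortExact`). [cite: Harari2020, Thm. 3.14 (proof)]
[cite: Lang1996, III §3 Thm. 3.2] -/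
theorem IsClassModule.δ_splittingShortComplex_res_tensor_bijective (hC : IsClassModule C φ)
    (M : Rep.{0} ℤ G) [IsAddTorsionFree M.V] (U : Subgroup G) (n : ℕ) :
    haveI := PGroupModule.flat_of_isAddTorsionFree M
    Function.Bijective
      (groupCohomology.δ (splittingShortComplex_res_tensor_shortExact C φ U M) (n + 1) (n + 2) rfl) := by
  haveI := PGroupModule.flat_of_isAddTorsionFree M
  letI : Fintype U := Fintype.ofFinite U
  have hct := (hC.splittingShortComplex_tensor_shortExact M).2
  haveI := isIso_δ_of_isZero (splittingShortComplex_res_tensor_shortExact C φ U M) (n + 1)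
    (hct.isZero_groupCohomology_res U (n + 1)) (hct.isZero_groupCohomology_res U (n + 2))
  exact ConcreteCategory.bijective_of_isIso _

/-- **Tate–Nakayama as a cup product (Harari Thm. 3.14 as printed, degrees `≥ 1`).**  For a class module
`C` of the finite group `G` with fundamental class `[φ]` (`IsClassModule C φ`: `H¹(U, C) = 0` and
`H²(U, C)` cyclic of order `|U|` generated by `res_U[φ]` for every subgroup `U`), every torsion-free `M`,
every subgroup `U` and every `n ≥ 1`, "the cup-product by `a_U = Res_U(a)`"
`x ↦ res_U[φ] ∪ x : Hⁿ(U, M) → Hⁿ⁺²(U, C ⊗ M)` is BIJECTIVE: by `cupProductRep_res_H2π_eq_δ_δ` it is the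
composite of `x ↦ ζ ∪ x` (the unitor) and the two connecting ISOMORPHISMS — door-c4's `tateNakayamaIso`
is this cup product. [cite: Harari2020, Prop. 3.13, Thm. 3.14] [cite: Lang1996, III §3 Thm. 3.2] -/
theorem IsClassModule.cupProductRep_H2π_bijective (hC : IsClassModule C φ) (M : Rep.{0} ℤ G)
    [IsAddTorsionFree M.V] (U : Subgroup G) (n : ℕ) [NeZero n] :
    Function.Bijective (fun x : groupCohomology (Rep.res U.subtype M) n =>
      cupProductRep (Rep.res U.subtype C) (Rep.res U.subtype M) (Nat.add_comm 2 n)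
        (map U.subtype (𝟙 (Rep.res U.subtype C)) 2 (H2π C φ)) x) := by
  haveI := PGroupModule.flat_of_isAddTorsionFree M
  have h : (fun x : groupCohomology (Rep.res U.subtype M) n =>
      cupProductRep (Rep.res U.subtype C) (Rep.res U.subtype M) (Nat.add_comm 2 n)
        (map U.subtype (𝟙 (Rep.res U.subtype C)) 2 (H2π C φ)) x) =
      (fun z => groupCohomology.δ (splittingShortComplex_res_tensor_shortExact C φ U M) (n + 1) (n + 2) rfl z) ∘
        (fun y => groupCohomology.δ (augShortComplex_res_tensor_shortExact U M) n (n + 1) rfl y) ∘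
          (fun x : groupCohomology (Rep.res U.subtype M) n =>
            cupProductRep (Rep.res U.subtype (Rep.trivial ℤ G ℤ)) (Rep.res U.subtype M) (zero_add n)
              ((H0Iso (Rep.res U.subtype (Rep.trivial ℤ G ℤ))).inv (zeta ℤ U)) x) :=
    funext fun x => cupProductRep_res_H2π_eq_δ_δ C φ U M x
  rw [h]
  exact ((hC.δ_splittingShortComplex_res_tensor_bijective M U n).comp
    (δ_augShortComplex_res_tensor_bijective M U n)).comp (cupProductRep_zeta_bijective U M)

end ClassModule

end Literature.Algebra.Homology

end
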